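import Summits.ResolutionOfSingularities.ResolutionOfSingularities.Theorems.EquisingularLiftEquisingularLiftNatSpecimenQuarticPointStep
import Literature.AlgebraicGeometry.Motives.HypersurfaceFormsIrreducible
import Literature.AlgebraicGeometry.Resolution.RegularHomReduced
import Mathlib.RingTheory.RegularLocalRing.Polynomial
import Mathlib.Algebra.MvPolynomial.PDeriv
import HarnessLib

/-!
# [OURS · L1 W4.5(b)] EL♮ specimen family T-ISO-CONE — the FERMAT CONES `x₁ᵈ + x₂ᵈ + x₃ᵈ`: chart algebra of the
# blow-up of the vertex (crux `Theses.EquisingularLift.EquisingularLiftNat`, stmt-ResolutionOfSingularities-20038)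

NOT a statement of any manuscript; OURS kernel specimen (cell `res-hironaka`, chain w45b, CHAIN v7.4 §3 row T-ISO-1
«assembly hand free», step 0; seat res-D-pv-013, own initiative, counted 0). AI-written, weaker than expert review.

The specimen surfaces are the cones `H_d = V₊(x₁ᵈ + x₂ᵈ + x₃ᵈ) ⊂ ℙ³_k` over the Fermat plane curves, `d ≥ 1` with
`d ≠ 0` in `k`: an ISOLATED singular point at the vertex `[1:0:0:0]` (an ordinary `d`-fold point with smooth tangent
cone; `A₁`-cone for `d = 2`, simple-elliptic `Ẽ₆` for `d = 3`, a non-rational cone singularity for `d ≥ 4`), resolved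
by ONE point blow-up. This file is the COMMUTATIVE ALGEBRA of «`Bl_vertex H_d` is regular»: on the chart `D₊(x₀)` with
coordinates `y = (y₀, y₁, y₂) = (x₁, x₂, x₃)` the cone is `V(f₀)`, `f₀ = y₀ᵈ + y₁ᵈ + y₂ᵈ`, the centre is the origin
`𝔪 = (y₀, y₁, y₂)` (the tree's `PointBlowup.originIdeal 2 k`, charts `PointBlowup.Chart 2 k i = A[𝔪/yᵢ] ≅ k[T₀,T₁,T₂]`
of `PointBlowupAlgebraCharts.lean` / res-L1-w45b-stub-4's `exists_ringEquiv_pointChart`), and on the chart `yᵢ` the strict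
transform is `f₀ = yᵢᵈ · (1 + Σ_{j ≠ i} (y_j/yᵢ)ᵈ)`, so that (Görtz–Wedhorn Prop. 13.96 (2),
`blowupAlgebra.quotientKerMapQuotientEquiv`)

  `(A/(f₀))[𝔪̄/ȳᵢ] ≅ A[𝔪/yᵢ]/(1 + Σ_{j≠i}(y_j/yᵢ)ᵈ) ≅ k[T₀,T₁,T₂]/(1 + T_aᵈ + T_bᵈ)`  (`{a, b} = {0,1,2} ∖ {i}`),

the affine Fermat curve times a line — REGULAR by the prime-wise derivation criterion (Stacks 07PF, stub-4's
`isRegularRing_quotient_of_derivations`: at a prime `Q ∋ 1 + T_aᵈ + T_bᵈ` the partials `d·T_aᵈ⁻¹`, `d·T_bᵈ⁻¹` cannot both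
lie in `Q`). On the charts `D₊(x_c)`, `c ≥ 1`, the cone is `V(f₁)`, `f₁ = 1 + y₁ᵈ + y₂ᵈ` (no `y₀`): the same regular ring,
and the centre is the unit ideal there. Everything is PROVED; there are no definitions (the chart equations are written out).

* `pderiv_fermatAffine`, `isRegularRing_quotient_fermatAffine` (`k[T]/(1 + T_aᵈ + T_bᵈ)` regular, `a ≠ b`),
  `radical_span_fermatAffine`; `isRegularRing_quotient_f₁`, `radical_span_f₁`;
* `isRegularRing_vertexChart_of` (parametric in the chart index `i` and the two other indices), `isRegularRing_vertexChart`
  (`i = 0, 1, 2`): the three strict-transform charts `(A/(f₀))[𝔪̄/ȳᵢ]` are regular rings;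
* `prime_f₀` (`k` algebraically closed: Eisenstein at `(ζ, 1)`, `ζᵈ = −1`, via the tree's `irreducible_X_pow_add_C`),
  `radical_span_f₀`.

References: Görtz–Wedhorn I Prop. 13.96 (2); The Stacks Project, Tags 07PF, 0BIQ, 0804; Hartshorne I Ex. 5.5 — through the
cited tree files (…NatSpecimenQuarticPointStep / …QuarticDerivations, PointBlowupAlgebraCharts, HypersurfaceFormsIrreducible).
-/

set_option linter.dupNamespace false -- mandated namespace `Summit.<Summit>.<Problem>` of this single-conjunct summit

noncomputable section

open MvPolynomial
open Literature.AlgebraicGeometry.Resolution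
open Summit.ResolutionOfSingularities.ResolutionOfSingularities.Theorems.EquisingularLift.SpecimenQuartic

namespace Summit.ResolutionOfSingularities.ResolutionOfSingularities.Cruxes.EquisingularLiftNat.Sections

namespace FermatCone

variable (k : Type) [Field k] (d : ℕ)

/-! Throughout, `f₀ = y₀ᵈ + y₁ᵈ + y₂ᵈ` (vertex chart `D₊(x₀)`, `y = (x₁, x₂, x₃)`) and `f₁ = 1 + y₁ᵈ + y₂ᵈ` (charts
`D₊(x_c)`, `c ≥ 1`) are written out as polynomials of `k[y₀, y₁, y₂] = MvPolynomial (Fin 3) k` (no definitions). -/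

/-! ## The affine Fermat curve times a line: `k[T₀,T₁,T₂]/(1 + T_aᵈ + T_bᵈ)` is regular -/

/-- `∂/∂T_a (1 + T_aᵈ + T_bᵈ) = d·T_aᵈ⁻¹` for `a ≠ b`. [folklore] -/
theorem pderiv_fermatAffine (a b : Fin 3) (hab : a ≠ b) :
    (pderiv a : Derivation k (MvPolynomial (Fin 3) k) (MvPolynomial (Fin 3) k)) (1 + X a ^ d + X b ^ d) =
      (d : MvPolynomial (Fin 3) k) * X a ^ (d - 1) := by
  simp [Derivation.leibniz_pow, pderiv_X_of_ne hab.symm, smul_eq_mul, nsmul_eq_mul]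

variable {k d} in
/-- In a prime ideal, `d · x ^ (d-1) ∈ Q` with `d ≠ 0` in `k` forces `x ^ d ∈ Q`. [folklore] -/
theorem pow_mem_of_natCast_mul_pow_mem (hdk : (d : k) ≠ 0) {Q : Ideal (MvPolynomial (Fin 3) k)} (hQ : Q.IsPrime)
    {x : MvPolynomial (Fin 3) k} (h : (d : MvPolynomial (Fin 3) k) * x ^ (d - 1) ∈ Q) : x ^ d ∈ Q := by
  have hd1 : 1 ≤ d := Nat.one_le_iff_ne_zero.mpr (by rintro rfl; exact hdk (by simp))
  have hunit : IsUnit (d : MvPolynomial (Fin 3) k) := by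
    have h1 : IsUnit (C (d : k) : MvPolynomial (Fin 3) k) := (IsUnit.mk0 _ hdk).map C
    rwa [map_natCast] at h1
  have hx : x ^ (d - 1) ∈ Q := by
    rcases hQ.mem_or_mem h with h' | h'
    · exact absurd (Q.eq_top_of_isUnit_mem h' hunit) hQ.ne_top
    · exact h'
  have := Q.mul_mem_left x hx
  rwa [← pow_succ', Nat.sub_add_cancel hd1] at this

/-- **`k[T₀,T₁,T₂]/(1 + T_aᵈ + T_bᵈ)` is a regular ring** for `a ≠ b` and `d ≠ 0` in `k` (the smooth affine Fermat curve
times a line): at a prime `Q ∋ g = 1 + T_aᵈ + T_bᵈ` the partials `∂_a g = d·T_aᵈ⁻¹` and `∂_b g = d·T_bᵈ⁻¹` cannot both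
lie in `Q` (else `T_aᵈ, T_bᵈ ∈ Q` and `1 = g − T_aᵈ − T_bᵈ ∈ Q`); Stacks 07PF with several derivations.
[cite: StacksProject, Tag 07PF] -/
theorem isRegularRing_quotient_fermatAffine (hdk : (d : k) ≠ 0) (a b : Fin 3) (hab : a ≠ b) :
    IsRegularRing (MvPolynomial (Fin 3) k ⧸ Ideal.span {(1 + X a ^ d + X b ^ d : MvPolynomial (Fin 3) k)}) := by
  refine isRegularRing_quotient_of_derivations (S₀ := k) _ fun Q hQ hgQ => ?_
  by_contra hnone
  simp only [not_exists, not_not] at hnone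
  have ha : X a ^ d ∈ Q := by
    refine pow_mem_of_natCast_mul_pow_mem hdk hQ ?_
    rw [← pderiv_fermatAffine k d a b hab]
    exact hnone _
  have hb : X b ^ d ∈ Q := by
    refine pow_mem_of_natCast_mul_pow_mem hdk hQ ?_
    rw [← pderiv_fermatAffine k d b a hab.symm, show (1 + X b ^ d + X a ^ d : MvPolynomial (Fin 3) k) =
      1 + X a ^ d + X b ^ d by ring]
    exact hnone _
  have h1 : (1 : MvPolynomial (Fin 3) k) = (1 + X a ^ d + X b ^ d) - X a ^ d - X b ^ d := by ring
  have h1Q : (1 : MvPolynomial (Fin 3) k) ∈ Q := by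
    rw [h1]
    exact Q.sub_mem (Q.sub_mem hgQ ha) hb
  exact hQ.ne_top ((Ideal.eq_top_iff_one _).mpr h1Q)

/-- `(1 + T_aᵈ + T_bᵈ)` is a radical ideal (its quotient is regular, hence reduced). [folklore] -/
theorem radical_span_fermatAffine (hdk : (d : k) ≠ 0) (a b : Fin 3) (hab : a ≠ b) :
    (Ideal.span {(1 + X a ^ d + X b ^ d : MvPolynomial (Fin 3) k)}).radical =
      Ideal.span {(1 + X a ^ d + X b ^ d : MvPolynomial (Fin 3) k)} := by
  haveI := isRegularRing_quotient_fermatAffine k d hdk a b hab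
  haveI := IsRegularRing.isReduced' (MvPolynomial (Fin 3) k ⧸ Ideal.span {(1 + X a ^ d + X b ^ d : MvPolynomial (Fin 3) k)})
  exact (Ideal.isRadical_iff_quotient_reduced _).mpr inferInstance |>.radical

/-- **The charts off the vertex are regular**: `k[y]/(f₁)`, `f₁ = 1 + y₁ᵈ + y₂ᵈ`, is a regular ring. [folklore] -/
theorem isRegularRing_quotient_f₁ (hdk : (d : k) ≠ 0) : IsRegularRing (MvPolynomial (Fin 3) k ⧸ Ideal.span {(1 + X 1 ^ d + X 2 ^ d : MvPolynomial (Fin 3) k)}) :=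
  isRegularRing_quotient_fermatAffine k d hdk 1 2 (by decide)

/-- `(f₁)` is a radical ideal. [folklore] -/
theorem radical_span_f₁ (hdk : (d : k) ≠ 0) : (Ideal.span {(1 + X 1 ^ d + X 2 ^ d : MvPolynomial (Fin 3) k)}).radical = Ideal.span {(1 + X 1 ^ d + X 2 ^ d : MvPolynomial (Fin 3) k)} :=
  radical_span_fermatAffine k d hdk 1 2 (by decide)

/-! ## The three strict-transform charts of the vertex blow-up -/

/-- **GENERIC VERTEX CHART.** Let `{i, a, b} = {0, 1, 2}` and `f₀ = yᵢᵈ + y_aᵈ + y_bᵈ`. In `A[𝔪/yᵢ]` one has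
`f₀ = yᵢᵈ · (1 + (y_a/yᵢ)ᵈ + (y_b/yᵢ)ᵈ)`, `yᵢ` is prime there and does not divide the second factor (its constant
coefficient is `1 ∉ 𝔪`, Stacks 0BIQ), so `(A/(f₀))[𝔪̄/ȳᵢ] ≅ A[𝔪/yᵢ]/(1 + (y_a/yᵢ)ᵈ + (y_b/yᵢ)ᵈ)` (GW 13.96 (2)); under
`θ : k[T] ≅ A[𝔪/yᵢ]` (`Tᵢ ↦ yᵢ`, `T_j ↦ y_j/yᵢ`) this is `k[T]/(1 + T_aᵈ + T_bᵈ)`, regular. [folklore; GW 13.96 (2)] -/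
theorem isRegularRing_vertexChart_of (hdk : (d : k) ≠ 0) (i a b : Fin 3) (hai : a ≠ i) (hbi : b ≠ i) (hab : a ≠ b)
    (hf : (X 0 ^ d + X 1 ^ d + X 2 ^ d : MvPolynomial (Fin 3) k) = X i ^ d + X a ^ d + X b ^ d) :
    IsRegularRing (blowupAlgebra ((PointBlowup.originIdeal 2 k).map (Ideal.Quotient.mk (Ideal.span {(X 0 ^ d + X 1 ^ d + X 2 ^ d : MvPolynomial (Fin 3) k)})))
      (Ideal.Quotient.mk (Ideal.span {(X 0 ^ d + X 1 ^ d + X 2 ^ d : MvPolynomial (Fin 3) k)}) (X i))) := by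
  have hd1 : 1 ≤ d := Nat.one_le_iff_ne_zero.mpr (by rintro rfl; exact hdk (by simp))
  obtain ⟨θ, hθi, hθj⟩ := exists_ringEquiv_pointChart k i
  -- the chart polynomial `G = 1 + T_aᵈ + T_bᵈ` over `A`, in the variables `j ≠ i`
  set G : MvPolynomial {j : Fin 3 // j ≠ i} (MvPolynomial (Fin 3) k) :=
    1 + X ⟨a, hai⟩ ^ d + X ⟨b, hbi⟩ ^ d with hG
  have hev : blowupAlgebra.eval (MvPolynomial.X : Fin 3 → MvPolynomial (Fin 3) k) i G =
      1 + PointBlowup.frac 2 k i a ^ d + PointBlowup.frac 2 k i b ^ d := by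
    simp only [hG, map_add, map_pow, map_one, blowupAlgebra.eval_X]
  -- `θ (1 + T_aᵈ + T_bᵈ) = G(y_a/yᵢ, y_b/yᵢ)`
  have hθg : θ (1 + X a ^ d + X b ^ d) = blowupAlgebra.eval (MvPolynomial.X : Fin 3 → MvPolynomial (Fin 3) k) i G := by
    rw [hev, map_add, map_add, map_one, map_pow, map_pow, hθj a hai, hθj b hbi]
  -- `f₀ = yᵢᵈ · G(…)` in `A[𝔪/yᵢ]`
  have hf' : algebraMap (MvPolynomial (Fin 3) k) (PointBlowup.Chart 2 k i) (X 0 ^ d + X 1 ^ d + X 2 ^ d : MvPolynomial (Fin 3) k) =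
      algebraMap (MvPolynomial (Fin 3) k) (PointBlowup.Chart 2 k i) (X i) ^ d *
        blowupAlgebra.eval (MvPolynomial.X : Fin 3 → MvPolynomial (Fin 3) k) i G := by
    rw [hf, hev, map_add, map_add, map_pow, map_pow, map_pow, PointBlowup.algebraMap_X 2 k i a,
      PointBlowup.algebraMap_X 2 k i b]
    ring
  -- `yᵢ ∤ G(…)`: the constant coefficient of `G` is `1 ∉ 𝔪`
  have hndvd : ¬ algebraMap (MvPolynomial (Fin 3) k) (PointBlowup.Chart 2 k i) (X i) ∣
      blowupAlgebra.eval (MvPolynomial.X : Fin 3 → MvPolynomial (Fin 3) k) i G := by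
    intro h
    have hm := (blowupAlgebra.eval_mem_span_algebraMap_iff (MvPolynomial.X : Fin 3 → MvPolynomial (Fin 3) k) i
      (isQuasiRegular_X k) G).mp (Ideal.mem_span_singleton.mpr h) 0
    have hc : G.coeff 0 = 1 := by
      classical
      have hne : Finsupp.single (⟨a, hai⟩ : {j : Fin 3 // j ≠ i}) d ≠ 0 := Finsupp.single_ne_zero.mpr (by omega)
      have hne' : Finsupp.single (⟨b, hbi⟩ : {j : Fin 3 // j ≠ i}) d ≠ 0 := Finsupp.single_ne_zero.mpr (by omega)
      rw [hG, coeff_add, coeff_add, coeff_one, if_pos rfl, coeff_X_pow, coeff_X_pow, if_neg hne, if_neg hne']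
      ring
    rw [hc] at hm
    haveI := isDomain_quotient_origin k
    exact ((Ideal.Quotient.isDomain_iff_prime _).mp inferInstance).ne_top ((Ideal.eq_top_iff_one _).mpr hm)
  -- `k[T]/(1 + T_aᵈ + T_bᵈ) ≅ A[𝔪/yᵢ]/(G(…))` is regular
  have hmap : Ideal.map θ (Ideal.span {(1 + X a ^ d + X b ^ d : MvPolynomial (Fin 3) k)}) =
      Ideal.span {blowupAlgebra.eval (MvPolynomial.X : Fin 3 → MvPolynomial (Fin 3) k) i G} := by
    rw [Ideal.map_span, Set.image_singleton]
    exact congrArg _ (congrArg _ hθg)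
  haveI := isRegularRing_quotient_fermatAffine k d hdk a b hab
  haveI hreg : IsRegularRing (PointBlowup.Chart 2 k i ⧸
      Ideal.span {blowupAlgebra.eval (MvPolynomial.X : Fin 3 → MvPolynomial (Fin 3) k) i G}) :=
    IsRegularRing.of_ringEquiv (Ideal.quotientEquiv _ _ θ hmap.symm)
  exact IsRegularRing.of_ringEquiv
    (R := PointBlowup.Chart 2 k i ⧸ Ideal.span {blowupAlgebra.eval (MvPolynomial.X : Fin 3 → MvPolynomial (Fin 3) k) i G})
    (blowupAlgebra.quotientKerMapQuotientEquiv _ _ hf' (prime_exc k i) hndvd)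

/-- **The three strict-transform charts `(A/(f₀))[𝔪̄/ȳᵢ]` (`i = 0, 1, 2`) of the vertex blow-up of the Fermat cone are
regular rings** (`d ≠ 0` in `k`). [folklore; GW 13.96 (2), Stacks 07PF] -/
theorem isRegularRing_vertexChart (hdk : (d : k) ≠ 0) (i : Fin 3) :
    IsRegularRing (blowupAlgebra ((PointBlowup.originIdeal 2 k).map (Ideal.Quotient.mk (Ideal.span {(X 0 ^ d + X 1 ^ d + X 2 ^ d : MvPolynomial (Fin 3) k)})))
      (Ideal.Quotient.mk (Ideal.span {(X 0 ^ d + X 1 ^ d + X 2 ^ d : MvPolynomial (Fin 3) k)}) (X i))) := by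
  fin_cases i
  · exact isRegularRing_vertexChart_of k d hdk 0 1 2 (by decide) (by decide) (by decide) rfl
  · exact isRegularRing_vertexChart_of k d hdk 1 0 2 (by decide) (by decide) (by decide) (by ring)
  · exact isRegularRing_vertexChart_of k d hdk 2 0 1 (by decide) (by decide) (by decide) (by ring)

/-! ## `f₀` is prime -/

/-- In `y₀`-adic form, `f₀ = Y^d + C(z₀ᵈ + z₁ᵈ)` over `k[z₀, z₁]` (`z = (y₁, y₂)`). [folklore] -/
theorem finSuccEquiv_f₀ :
    finSuccEquiv k 2 (X 0 ^ d + X 1 ^ d + X 2 ^ d : MvPolynomial (Fin 3) k) = Polynomial.X ^ d + Polynomial.C (X 0 ^ d + X 1 ^ d) := by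
  have h1 : finSuccEquiv k 2 (X 1) = Polynomial.C (X 0) := finSuccEquiv_X_succ (j := 0)
  have h2 : finSuccEquiv k 2 (X 2) = Polynomial.C (X 1) := finSuccEquiv_X_succ (j := 1)
  simp only [map_add, map_pow, finSuccEquiv_X_zero, h1, h2]
  ring

/-- **`f₀ = y₀ᵈ + y₁ᵈ + y₂ᵈ` is prime** over an algebraically closed field with `d ≠ 0` in `k` (`d ≥ 1`): Eisenstein at the
point `(ζ, 1)` of `k[z₀, z₁]`, `ζᵈ = −1` (the tree's `irreducible_X_pow_add_C`; Hartshorne I Ex. 5.5). [folklore] -/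
theorem prime_f₀ [IsAlgClosed k] (hdk : (d : k) ≠ 0) : Prime (X 0 ^ d + X 1 ^ d + X 2 ^ d : MvPolynomial (Fin 3) k) := by
  have hd1 : 1 ≤ d := Nat.one_le_iff_ne_zero.mpr (by rintro rfl; exact hdk (by simp))
  obtain ⟨ζ, hζ⟩ := IsAlgClosed.exists_pow_nat_eq (-1 : k) (n := d) hd1
  have hζ0 : ζ ≠ 0 := by
    rintro rfl
    rw [zero_pow (by omega)] at hζ
    exact one_ne_zero (neg_eq_zero.mp hζ.symm)
  have hirr : Irreducible (X 0 ^ d + X 1 ^ d + X 2 ^ d : MvPolynomial (Fin 3) k) := by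
    rw [← MulEquiv.irreducible_iff (finSuccEquiv k 2), finSuccEquiv_f₀]
    refine Literature.AlgebraicGeometry.Motives.SmoothHypersurface.irreducible_X_pow_add_C hd1 _ ![ζ, 1] ?_ 0 ?_
    · simp [hζ]
    · have h : (pderiv 0 : Derivation k (MvPolynomial (Fin 2) k) (MvPolynomial (Fin 2) k)) (X 0 ^ d + X 1 ^ d) =
          (d : MvPolynomial (Fin 2) k) * X 0 ^ (d - 1) := by
        simp [Derivation.leibniz_pow, pderiv_X_of_ne (show (1 : Fin 2) ≠ 0 by decide), smul_eq_mul, nsmul_eq_mul]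
      rw [h]
      simp only [map_mul, map_natCast, map_pow, MvPolynomial.eval_X, Matrix.cons_val_zero]
      exact mul_ne_zero hdk (pow_ne_zero _ hζ0)
  exact UniqueFactorizationMonoid.irreducible_iff_prime.mp hirr

/-- `(f₀)` is a radical ideal. [folklore] -/
theorem radical_span_f₀ [IsAlgClosed k] (hdk : (d : k) ≠ 0) : (Ideal.span {(X 0 ^ d + X 1 ^ d + X 2 ^ d : MvPolynomial (Fin 3) k)}).radical = Ideal.span {(X 0 ^ d + X 1 ^ d + X 2 ^ d : MvPolynomial (Fin 3) k)} :=
  ((Ideal.span_singleton_prime (prime_f₀ k d hdk).ne_zero).mpr (prime_f₀ k d hdk)).radical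

end FermatCone

end Summit.ResolutionOfSingularities.ResolutionOfSingularities.Cruxes.EquisingularLiftNat.Sections

end
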